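import Summits.CriticalPhenomena.PercolationContinuityZ3.Theorems.Transplant.KNCells2ChainAdv
import HarnessLib

/-!
# Corridor chains of route D″ v2 — the STRAIGHT BAND RUN (Kozma–Nitzan's Lemma 11′ as a planar schedule, P4-GENERAL §16.2 (i) / table 16.4
# (U2′)(U2″), DPRIME-SCOPE §2 L6′ "LEVEL 1"): the routes of the walkers are BAND RECTANGLES `v + [−ℓ, ℓ] × [−Wb ℓ, Wb ℓ]` (extent `ℓ` along the
# axis = the distance to the next line, transverse half-width `Wb ℓ` = the band value `G(ℓ)` / `F⁻¹(ℓ)`) with their DIRECTED SIDE on the next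
# line and the SIDE-HALF towards the corridor axis as the target piece — the rectangle-for-square twin of `ChainPlanar.route_advance` /
# `route_start` / `Adv.*` (`KNCells2ChainPlanar`, `KNCells2ChainAdv`); pure `Site 2` geometry

builds on p205010 (kernel theorem, internal audit signed; external expert review pending) — nothing in this file uses p205010.
Lane `prim-bschramm`, seat `prim-bschramm-p1` (gen 9; LEVEL-1 groundwork offered in the lane INBOX 2026-08-21 ≈04:45Z); helper file
(`--supports stmt-CriticalPhenomena-4575 --as helper`).

Parameters `q q' s₁ ρ : ℤ`, `R' ℓ₀ N WM : ℕ`, `Wb : ℕ → ℕ` with `BandOK`: `0 ≤ q`, `0 ≤ q'`, `R' + ℓ₀ ≤ s₁`, `2R' ≤ s₁`, `3q + s₁ + 2R' ≤ ρ`,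
`q' + (N + 1) R' + 2 WM ≤ ρ`, and `Wb ℓ ≤ WM` for every extent `ℓ ≤ 2q + s₁ + R'` that occurs.  `core 0 = {|level| ≤ q, |trans| ≤ q'}`,
`core k = {level = q + k s₁, |trans| ≤ w₁ + (k-1) R'}` (`k ≥ 1`, `w₁ = q' + R' + WM`); `region 0 = {-ρ ≤ level ≤ q + s₁, |trans| ≤ ρ}`,
`region k = {q + (k-2) s₁ ≤ level ≤ q + (k+1) s₁, |trans| ≤ ρ}` (the regions of `Adv`).  For a walker `v` within `R'` of `core k` the extent is
`ℓ(v) = (q + (k+1) s₁) − level(v) ∈ [s₁ − R', s₁ + R']` (`k ≥ 1`; `∈ [s₁ − R', 2q + s₁ + R']` for `k = 0`), the band rectangle about `v` lies in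
`region k`, its `σ`-side lies ON the line of `core (k+1)` and the half of that side pointing towards the corridor axis lies in `core (k+1)`
(target half-width grows by `R'` per step and dominates `WM`, table 16.4 (U2′): `w_{i+1} = max(w_i + R′, G(3e))`).
* §1 `route_band_advance`, `route_band_start` (pointwise planar statements: `|y_a − v_a| ≤ ℓ → |y_{a'} − v_{a'}| ≤ Wb ℓ → y ∈ region`, and
  `y_a − v_a = σ ℓ → 0 ≤ τ (y_{a'} − v_{a'}) → |y_{a'} − v_{a'}| ≤ Wb ℓ → y ∈ next core` — the membership shapes of `Skelφ.rcyl` / `Skelφ.rhalf`);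
* §2 `Band.w₁`, `Band.coreW`, `Band.core`, `Band.region` (= `Adv.region`), `Band.BandOK`, `Band.core_params`, **`Band.core_route`**,
  `Band.enlarge_core_subset_region`, `Band.core_succ_subset_region`, `Band.region_subset_prism`, `Band.core_nonempty`, `Band.core_zero_last`.
[cite: KozmaNitzan2024, §4 Lemma 11 (pp. 22–23: "choose ℓ(v) = ¾r − v₁ … F(v) = {1} × ∏ [0,1] or [−1,0]")]
-/

noncomputable section

namespace Summit.CriticalPhenomena.PercolationContinuityZ3.Theorems

namespace Transplant

namespace ChainPlanar

open Literature.Probability.Percolation Literature.Probability.LatticeModels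
open Literature.Probability.Percolation.KozmaNitzan
open Literature.Probability.Percolation.KozmaNitzan.Cells (oth oth_ne eq_oth_of_ne)

/-! ## §1 Band-rectangle routes: the advance step and the start step -/

/-- **BAND ROUTE FOR THE ADVANCE STEP** (KN p. 22 with a band rectangle): centre `c`, axis `a`, sign `σ`; current line `L`, width `w`; spacing
`s`; neighbourhood radius `R'`; minimal extent `ℓ₀`; transverse band width `Wb` bounded by `WM` on `[0, s + R']`; region half-width `ρ`;
`R' + ℓ₀ ≤ s`, `2R' ≤ s`, `w + R' + WM ≤ ρ`.  For every `v` with `L - R' ≤ level(v) ≤ L + R'` and `|trans(v)| ≤ w + R'`, the extent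
`ℓ = L + s - level(v)` satisfies `ℓ₀ ≤ ℓ ≤ s + R'`; every planar point `y` with `|y_a − v_a| ≤ ℓ`, `|y_{a'} − v_{a'}| ≤ Wb ℓ` lies in the region
`sBox a σ c (L - 2s) (L + s) ρ`; and for a sign `τ` (towards the axis) every `y` on the `σ`-side (`y_a − v_a = σ ℓ`) in the `τ`-half
(`0 ≤ τ (y_{a'} − v_{a'})`, `|y_{a'} − v_{a'}| ≤ Wb ℓ`) lies in the next core `sBox a σ c (L + s) (L + s) (max (w + R') WM)`.
[cite: KozmaNitzan2024, §4 Lemma 11 (pp. 22–23)] -/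
theorem route_band_advance {a : Fin 2} {σ : ℤ} (hσ : σ = 1 ∨ σ = -1) (c : Site 2) {L s w ρ : ℤ} {R' ℓ₀ WM : ℕ} (Wb : ℕ → ℕ)
    (hs : (R' : ℤ) + ℓ₀ ≤ s) (hs2 : 2 * (R' : ℤ) ≤ s) (hWM : ∀ ℓ : ℕ, (ℓ : ℤ) ≤ s + R' → Wb ℓ ≤ WM) (hρ : w + R' + WM ≤ ρ)
    {v : Site 2} (hv : v ∈ sBox a σ c (L - R') (L + R') (w + R')) :
    ∃ ℓ : ℕ, ℓ₀ ≤ ℓ ∧ (ℓ : ℤ) ≤ s + R' ∧ (ℓ : ℤ) = L + s - σ * (v a - c a) ∧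
      (∀ y : Site 2, |y a - v a| ≤ ℓ → |y (oth a) - v (oth a)| ≤ Wb ℓ → y ∈ sBox a σ c (L - 2 * s) (L + s) ρ) ∧
      ∃ τ : ℤ, (τ = 1 ∨ τ = -1) ∧ ∀ y : Site 2, y a - v a = σ * ℓ → 0 ≤ τ * (y (oth a) - v (oth a)) →
        |y (oth a) - v (oth a)| ≤ Wb ℓ → y ∈ sBox a σ c (L + s) (L + s) (max (w + R') WM) := by
  rw [mem_sBox_iff hσ] at hv
  obtain ⟨⟨hv1, hv2⟩, hvj⟩ := hv
  have hvo := hvj (oth a) (oth_ne a)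
  have hℓ0 : 0 ≤ L + s - σ * (v a - c a) := by omega
  obtain ⟨ℓ, hℓ⟩ : ∃ ℓ : ℕ, (ℓ : ℤ) = L + s - σ * (v a - c a) := ⟨_, Int.toNat_of_nonneg hℓ0⟩
  have hℓlo : (ℓ₀ : ℤ) ≤ ℓ := by omega
  have hℓhi : (ℓ : ℤ) ≤ s + R' := by omega
  have hW : ((Wb ℓ : ℕ) : ℤ) ≤ WM := by exact_mod_cast hWM ℓ hℓhi
  have hmaxl : w + R' ≤ max (w + R') (WM : ℤ) := le_max_left _ _
  have hmaxr : (WM : ℤ) ≤ max (w + R') (WM : ℤ) := le_max_right _ _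
  refine ⟨ℓ, by exact_mod_cast hℓlo, hℓhi, hℓ, fun y hya hyo => ?_, ?_⟩
  · rw [mem_sBox_iff hσ]
    rw [abs_le] at hya hyo
    refine ⟨?_, fun j hj => ?_⟩
    · rcases hσ with rfl | rfl <;> constructor <;> linarith [hya.1, hya.2]
    · rw [eq_oth_of_ne hj]
      constructor <;> linarith [hyo.1, hyo.2, hvo.1, hvo.2]
  · refine ⟨if c (oth a) < v (oth a) then -1 else 1, by split_ifs <;> simp, fun y hya hτ hyo => ?_⟩
    rw [mem_sBox_iff hσ]
    rw [abs_le] at hyo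
    have hσσ : σ * σ = 1 := by rcases hσ with h | h <;> simp [h]
    refine ⟨?_, fun j hj => ?_⟩
    · have : σ * (y a - c a) = σ * (v a - c a) + ℓ := by
        have h1 : y a - c a = (v a - c a) + σ * ℓ := by linarith
        rw [h1, mul_add, ← mul_assoc, hσσ, one_mul]
      rw [this]; constructor <;> omega
    · rw [eq_oth_of_ne hj]
      by_cases hlt : c (oth a) < v (oth a)
      · rw [if_pos hlt] at hτ
        constructor <;> linarith [hyo.1, hyo.2, hvo.1, hvo.2]
      · rw [if_neg hlt] at hτ
        push Not at hlt
        constructor <;> linarith [hyo.1, hyo.2, hvo.1, hvo.2]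

/-- **BAND ROUTE FOR THE START STEP** (from `v` within `R'` of the small box `{|level| ≤ q, |trans| ≤ q'}`): the extent `ℓ = q + s − level(v) ∈
[s − R', 2q + s + R']`, the band rectangle inside `sBox a σ c (−ρ) (q + s) ρ`, the half of its `σ`-side towards the axis inside the first core
`sBox a σ c (q + s) (q + s) (max (q' + R') WM)`; needs `R' + ℓ₀ ≤ s`, `Wb ≤ WM` on `[0, 2q + s + R']`, `q' + R' + WM ≤ ρ`, `3q + s + 2R' ≤ ρ`.
[cite: KozmaNitzan2024, §4 Lemma 11 (pp. 22–23)] -/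
theorem route_band_start {a : Fin 2} {σ : ℤ} (hσ : σ = 1 ∨ σ = -1) (c : Site 2) {q q' s ρ : ℤ} {R' ℓ₀ WM : ℕ} (Wb : ℕ → ℕ)
    (hs : (R' : ℤ) + ℓ₀ ≤ s) (hWM : ∀ ℓ : ℕ, (ℓ : ℤ) ≤ 2 * q + s + R' → Wb ℓ ≤ WM) (hρ : q' + R' + WM ≤ ρ)
    (hρ' : 3 * q + s + 2 * R' ≤ ρ) {v : Site 2} (hv : v ∈ sBox a σ c (-q - R') (q + R') (q' + R')) :
    ∃ ℓ : ℕ, ℓ₀ ≤ ℓ ∧ (ℓ : ℤ) ≤ 2 * q + s + R' ∧ (ℓ : ℤ) = q + s - σ * (v a - c a) ∧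
      (∀ y : Site 2, |y a - v a| ≤ ℓ → |y (oth a) - v (oth a)| ≤ Wb ℓ → y ∈ sBox a σ c (-ρ) (q + s) ρ) ∧
      ∃ τ : ℤ, (τ = 1 ∨ τ = -1) ∧ ∀ y : Site 2, y a - v a = σ * ℓ → 0 ≤ τ * (y (oth a) - v (oth a)) →
        |y (oth a) - v (oth a)| ≤ Wb ℓ → y ∈ sBox a σ c (q + s) (q + s) (max (q' + R') WM) := by
  rw [mem_sBox_iff hσ] at hv
  obtain ⟨⟨hv1, hv2⟩, hvj⟩ := hv
  have hvo := hvj (oth a) (oth_ne a)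
  have hℓ0 : 0 ≤ q + s - σ * (v a - c a) := by omega
  obtain ⟨ℓ, hℓ⟩ : ∃ ℓ : ℕ, (ℓ : ℤ) = q + s - σ * (v a - c a) := ⟨_, Int.toNat_of_nonneg hℓ0⟩
  have hℓlo : (ℓ₀ : ℤ) ≤ ℓ := by omega
  have hℓhi : (ℓ : ℤ) ≤ 2 * q + s + R' := by omega
  have hW : ((Wb ℓ : ℕ) : ℤ) ≤ WM := by exact_mod_cast hWM ℓ hℓhi
  have hmaxl : q' + R' ≤ max (q' + R') (WM : ℤ) := le_max_left _ _
  have hmaxr : (WM : ℤ) ≤ max (q' + R') (WM : ℤ) := le_max_right _ _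
  refine ⟨ℓ, by exact_mod_cast hℓlo, hℓhi, hℓ, fun y hya hyo => ?_, ?_⟩
  · rw [mem_sBox_iff hσ]
    rw [abs_le] at hya hyo
    refine ⟨?_, fun j hj => ?_⟩
    · rcases hσ with rfl | rfl <;> constructor <;> linarith [hya.1, hya.2]
    · rw [eq_oth_of_ne hj]
      constructor <;> linarith [hyo.1, hyo.2, hvo.1, hvo.2]
  · refine ⟨if c (oth a) < v (oth a) then -1 else 1, by split_ifs <;> simp, fun y hya hτ hyo => ?_⟩
    rw [mem_sBox_iff hσ]
    rw [abs_le] at hyo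
    have hσσ : σ * σ = 1 := by rcases hσ with h | h <;> simp [h]
    refine ⟨?_, fun j hj => ?_⟩
    · have : σ * (y a - c a) = σ * (v a - c a) + ℓ := by
        have h1 : y a - c a = (v a - c a) + σ * ℓ := by linarith
        rw [h1, mul_add, ← mul_assoc, hσσ, one_mul]
      rw [this]; constructor <;> omega
    · rw [eq_oth_of_ne hj]
      by_cases hlt : c (oth a) < v (oth a)
      · rw [if_pos hlt] at hτ
        constructor <;> linarith [hyo.1, hyo.2, hvo.1, hvo.2]
      · rw [if_neg hlt] at hτ
        push Not at hlt
        constructor <;> linarith [hyo.1, hyo.2, hvo.1, hvo.2]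

/-! ## §2 The straight band run: cores, regions, admissible parameters, routes -/

namespace Band

variable (q q' s₁ ρ : ℤ) (R' N WM : ℕ)

/-- The width of the first line core: `q' + R' + WM`. [folklore] -/
def w₁ : ℤ := q' + R' + WM

/-- Transverse half-width of core `k` of the band run. [folklore] -/
def coreW (k : ℕ) : ℤ := if k = 0 then q' else w₁ q' R' WM + ((k : ℤ) - 1) * R'

/-- **Core `k`** of the band run (centre `c`, axis `a`, sign `σ`): the small box for `k = 0`, the segment of half-width `coreW k` on the line
`level = q + k s₁` for `k ≥ 1`. [cite: KozmaNitzan2024, §4 Lemma 11 (p. 22)] -/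
def core (a : Fin 2) (σ : ℤ) (c : Site 2) (k : ℕ) : Finset (Site 2) :=
  sBox a σ c (Adv.coreα q s₁ k) (Adv.coreβ q s₁ k) (coreW q' R' WM k)

/-- **Region `k`** of the band run (those of the straight run `Adv.region`). [cite: KozmaNitzan2024, §4 Lemma 11 (p. 22: the slabs of Ω)] -/
def region (a : Fin 2) (σ : ℤ) (c : Site 2) (k : ℕ) : Finset (Site 2) := Adv.region q s₁ ρ a σ c k

/-- **Admissible parameters of a band run.** [cite: KozmaNitzan2024, §4 Lemma 11 (p. 22)] -/
structure BandOK (q q' s₁ ρ : ℤ) (R' ℓ₀ N WM : ℕ) (Wb : ℕ → ℕ) : Prop where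
  hq : 0 ≤ q
  hq' : 0 ≤ q'
  hs : (R' : ℤ) + ℓ₀ ≤ s₁
  hs2 : 2 * (R' : ℤ) ≤ s₁
  hρ0 : 3 * q + s₁ + 2 * R' ≤ ρ
  hρ : q' + ((N : ℤ) + 1) * R' + 2 * WM ≤ ρ
  hWM : ∀ ℓ : ℕ, (ℓ : ℤ) ≤ 2 * q + s₁ + R' → Wb ℓ ≤ WM

variable {q q' s₁ R' WM} in
/-- Parameters of core `0` and of the line cores. [folklore] -/
theorem core_params :
    (Adv.coreα q s₁ 0 = -q ∧ Adv.coreβ q s₁ 0 = q ∧ coreW q' R' WM 0 = q') ∧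
      ∀ k, 1 ≤ k → Adv.coreα q s₁ k = q + (k : ℤ) * s₁ ∧ Adv.coreβ q s₁ k = q + (k : ℤ) * s₁ ∧
        coreW q' R' WM k = w₁ q' R' WM + ((k : ℤ) - 1) * R' := by
  refine ⟨⟨by simp [Adv.coreα], by simp [Adv.coreβ], by simp [coreW]⟩, fun k hk => ?_⟩
  have hk0 : k ≠ 0 := by omega
  exact ⟨by simp [Adv.coreα, hk0], by simp [Adv.coreβ, hk0], by simp [coreW, hk0]⟩

variable {q q' s₁ ρ R' N WM} {ℓ₀ : ℕ} {Wb : ℕ → ℕ} {a : Fin 2} {σ : ℤ} (hσ : σ = 1 ∨ σ = -1) (c : Site 2)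
  (h : BandOK q q' s₁ ρ R' ℓ₀ N WM Wb)
include hσ h

/-- **BAND ROUTES** of the band run: for `k ≤ N` and `v` in the `R'`-enlargement of `core k`, an extent `ℓ ∈ [ℓ₀, 2q + s₁ + R']` with
`ℓ = (q + (k+1) s₁) − level(v)` such that the band rectangle `v + [−ℓ, ℓ] × [−Wb ℓ, Wb ℓ]` lies in `region k` and, for a sign `τ`, the
`τ`-half of its `σ`-side lies in `core (k+1)`. [cite: KozmaNitzan2024, §4 Lemma 11 (pp. 22–23)] -/
theorem core_route {k : ℕ} (hk : k ≤ N) {v : Site 2}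
    (hv : v ∈ sBox a σ c (Adv.coreα q s₁ k - R') (Adv.coreβ q s₁ k + R') (coreW q' R' WM k + R')) :
    ∃ ℓ : ℕ, ℓ₀ ≤ ℓ ∧ (ℓ : ℤ) ≤ 2 * q + s₁ + R' ∧ (ℓ : ℤ) = Adv.coreβ q s₁ (k + 1) - σ * (v a - c a) ∧
      (∀ y : Site 2, |y a - v a| ≤ ℓ → |y (oth a) - v (oth a)| ≤ Wb ℓ → y ∈ region q s₁ ρ a σ c k) ∧
      ∃ τ : ℤ, (τ = 1 ∨ τ = -1) ∧ ∀ y : Site 2, y a - v a = σ * ℓ → 0 ≤ τ * (y (oth a) - v (oth a)) →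
        |y (oth a) - v (oth a)| ≤ Wb ℓ → y ∈ core q q' s₁ R' WM a σ c (k + 1) := by
  obtain ⟨⟨e0α, e0β, e0W⟩, eF⟩ := core_params (q := q) (q' := q') (s₁ := s₁) (R' := R') (WM := WM)
  have hq := h.hq; have hq' := h.hq'; have hs := h.hs; have hs2 := h.hs2; have hρ0 := h.hρ0; have hρ := h.hρ; have hWM := h.hWM
  have hR0 : (0 : ℤ) ≤ R' := by positivity
  have hW0 : (0 : ℤ) ≤ WM := by positivity
  have hNR : (0 : ℤ) ≤ (N : ℤ) * R' := by positivity
  by_cases hk0 : k = 0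
  · subst hk0
    obtain ⟨e1α, e1β, e1W⟩ := eF 1 le_rfl
    rw [e0α, e0β, e0W] at hv
    obtain ⟨ℓ, hℓ0, hℓhi, hℓ, hrect, τ, hτ, hhalf⟩ := route_band_start hσ c (q := q) (q' := q') (s := s₁) (ρ := ρ) (R' := R')
      (ℓ₀ := ℓ₀) (WM := WM) Wb hs hWM (by nlinarith) hρ0 hv
    refine ⟨ℓ, hℓ0, hℓhi, by rw [e1β]; push_cast; linarith, fun y h1 h2 => ?_, τ, hτ, fun y h1 h2 h3 => ?_⟩
    · rw [region, Adv.region, if_pos rfl]; exact hrect y h1 h2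
    · rw [core, e1α, e1β, e1W, w₁]
      have hy := hhalf y h1 h2 h3
      push_cast
      refine sBox_mono hσ c (by linarith) (by linarith) ?_ hy
      exact max_le (by linarith) (by linarith)
  · have hk1 : 1 ≤ k := by omega
    obtain ⟨eα, eβ, eW⟩ := eF k hk1
    obtain ⟨eα', eβ', eW'⟩ := eF (k + 1) (by omega)
    have hkR : ((k : ℤ) - 1) * R' ≤ ((N : ℤ) - 1) * R' :=
      mul_le_mul_of_nonneg_right (by linarith [(by exact_mod_cast hk : (k : ℤ) ≤ N)]) hR0
    have hkR0 : 0 ≤ ((k : ℤ) - 1) * R' := mul_nonneg (by linarith [(by exact_mod_cast hk1 : (1 : ℤ) ≤ k)]) hR0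
    rw [eα, eβ, eW] at hv
    have hWM' : ∀ ℓ : ℕ, (ℓ : ℤ) ≤ s₁ + R' → Wb ℓ ≤ WM := fun ℓ hℓ => hWM ℓ (by linarith)
    obtain ⟨ℓ, hℓ0, hℓhi, hℓ, hrect, τ, hτ, hhalf⟩ := route_band_advance hσ c (L := q + (k : ℤ) * s₁) (s := s₁)
      (w := w₁ q' R' WM + ((k : ℤ) - 1) * R') (ρ := ρ) (R' := R') (ℓ₀ := ℓ₀) (WM := WM) Wb hs hs2 hWM' (by unfold w₁; nlinarith) hv
    refine ⟨ℓ, hℓ0, by linarith, by rw [eβ']; push_cast; linarith, fun y h1 h2 => ?_, τ, hτ, fun y h1 h2 h3 => ?_⟩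
    · rw [region, Adv.region, if_neg hk0]; exact hrect y h1 h2
    · rw [core, eα', eβ', eW']
      have hy := hhalf y h1 h2 h3
      push_cast
      refine sBox_mono hσ c (by linarith) (by linarith) ?_ hy
      exact max_le (by linarith) (by unfold w₁; linarith)

/-- **The `R'`-enlargement of core `k ≤ N` lies in region `k`.** [cite: KozmaNitzan2024, §4 Lemma 11 (p. 22)] -/
theorem enlarge_core_subset_region {k : ℕ} (hk : k ≤ N) :
    sBox a σ c (Adv.coreα q s₁ k - R') (Adv.coreβ q s₁ k + R') (coreW q' R' WM k + R') ⊆ region q s₁ ρ a σ c k := by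
  obtain ⟨⟨e0α, e0β, e0W⟩, eF⟩ := core_params (q := q) (q' := q') (s₁ := s₁) (R' := R') (WM := WM)
  have hq := h.hq; have hq' := h.hq'; have hs := h.hs; have hs2 := h.hs2; have hρ0 := h.hρ0; have hρ := h.hρ
  have hR0 : (0 : ℤ) ≤ R' := by positivity
  have hW0 : (0 : ℤ) ≤ WM := by positivity
  have hNR : (0 : ℤ) ≤ (N : ℤ) * R' := by positivity
  by_cases hk0 : k = 0
  · subst hk0
    rw [e0α, e0β, e0W, region, Adv.region, if_pos rfl]
    exact sBox_mono hσ c (by linarith) (by linarith) (by linarith)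
  · have hk1 : 1 ≤ k := by omega
    obtain ⟨eα, eβ, eW⟩ := eF k hk1
    have hkR : ((k : ℤ) - 1) * R' ≤ ((N : ℤ) - 1) * R' :=
      mul_le_mul_of_nonneg_right (by linarith [(by exact_mod_cast hk : (k : ℤ) ≤ N)]) hR0
    rw [eα, eβ, eW, region, Adv.region, if_neg hk0]
    exact sBox_mono hσ c (by linarith) (by linarith) (by unfold w₁; nlinarith)

/-- **The next core lies in region `k`** (`k ≤ N`). [cite: KozmaNitzan2024, §4 Lemma 11 (p. 22)] -/
theorem core_succ_subset_region {k : ℕ} (hk : k ≤ N) : core q q' s₁ R' WM a σ c (k + 1) ⊆ region q s₁ ρ a σ c k := by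
  obtain ⟨-, eF⟩ := core_params (q := q) (q' := q') (s₁ := s₁) (R' := R') (WM := WM)
  have hq := h.hq; have hq' := h.hq'; have hs := h.hs; have hs2 := h.hs2; have hρ0 := h.hρ0; have hρ := h.hρ
  have hR0 : (0 : ℤ) ≤ R' := by positivity
  have hW0 : (0 : ℤ) ≤ WM := by positivity
  obtain ⟨eα, eβ, eW⟩ := eF (k + 1) (by omega)
  have hkR : (((k + 1 : ℕ) : ℤ) - 1) * R' ≤ (N : ℤ) * R' :=
    mul_le_mul_of_nonneg_right (by push_cast; linarith [(by exact_mod_cast hk : (k : ℤ) ≤ N)]) hR0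
  have hkR0 : 0 ≤ (((k + 1 : ℕ) : ℤ) - 1) * R' := mul_nonneg (by push_cast; linarith [(Nat.cast_nonneg k : (0 : ℤ) ≤ k)]) hR0
  rw [core, eα, eβ, eW]
  by_cases hk0 : k = 0
  · subst hk0
    rw [region, Adv.region, if_pos rfl]
    push_cast
    exact sBox_mono hσ c (by linarith) (by linarith) (by unfold w₁; linarith)
  · rw [region, Adv.region, if_neg hk0]
    push_cast
    exact sBox_mono hσ c (by nlinarith) (by linarith) (by unfold w₁; nlinarith)

/-- **All regions lie in the prism** `{-ρ ≤ level ≤ q + (N+1) s₁, |trans| ≤ ρ}`. [cite: KozmaNitzan2024, §4 Lemma 11 (p. 22: Ω)] -/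
theorem region_subset_prism {k : ℕ} (hk : k ≤ N) : region q s₁ ρ a σ c k ⊆ sBox a σ c (-ρ) (q + ((N : ℤ) + 1) * s₁) ρ := by
  have hq := h.hq; have hs := h.hs; have hρ0 := h.hρ0
  have hR0 : (0 : ℤ) ≤ R' := by positivity
  have hs0 : 0 ≤ s₁ := by linarith
  have hNs : (0 : ℤ) ≤ (N : ℤ) * s₁ := by positivity
  rw [region]
  by_cases hk0 : k = 0
  · subst hk0; rw [Adv.region, if_pos rfl]
    exact sBox_mono hσ c le_rfl (by nlinarith) le_rfl
  · have hk1 : 1 ≤ k := by omega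
    rw [Adv.region, if_neg hk0]
    have hks : (k : ℤ) * s₁ ≤ (N : ℤ) * s₁ := mul_le_mul_of_nonneg_right (by exact_mod_cast hk) hs0
    have hks1 : s₁ ≤ (k : ℤ) * s₁ := by
      have : (1 : ℤ) * s₁ ≤ (k : ℤ) * s₁ := mul_le_mul_of_nonneg_right (by exact_mod_cast hk1) hs0
      linarith
    exact sBox_mono hσ c (by linarith) (by linarith) le_rfl

/-- **All cores are nonempty.** [folklore] -/
theorem core_nonempty (k : ℕ) : (core q q' s₁ R' WM a σ c k).Nonempty := by
  obtain ⟨⟨e0α, e0β, e0W⟩, eF⟩ := core_params (q := q) (q' := q') (s₁ := s₁) (R' := R') (WM := WM)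
  have hq := h.hq; have hq' := h.hq'
  have hR0 : (0 : ℤ) ≤ R' := by positivity
  have hW0 : (0 : ℤ) ≤ WM := by positivity
  rw [core]
  by_cases hk0 : k = 0
  · subst hk0; rw [e0α, e0β, e0W]; exact sBox_nonempty hσ c (by linarith) hq'
  · obtain ⟨eα, eβ, eW⟩ := eF k (by omega)
    have hkR0 : 0 ≤ ((k : ℤ) - 1) * R' := mul_nonneg (by linarith [(by exact_mod_cast (by omega : 1 ≤ k) : (1 : ℤ) ≤ k)]) hR0
    rw [eα, eβ, eW]; exact sBox_nonempty hσ c le_rfl (by unfold w₁; linarith)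

omit hσ h in
/-- **The first core and the last core.** [folklore] -/
theorem core_zero_last :
    core q q' s₁ R' WM a σ c 0 = sBox a σ c (-q) q q' ∧
      core q q' s₁ R' WM a σ c (N + 1) = sBox a σ c (q + ((N : ℤ) + 1) * s₁) (q + ((N : ℤ) + 1) * s₁) (w₁ q' R' WM + (N : ℤ) * R') := by
  obtain ⟨⟨e0α, e0β, e0W⟩, eF⟩ := core_params (q := q) (q' := q') (s₁ := s₁) (R' := R') (WM := WM)
  obtain ⟨eα, eβ, eW⟩ := eF (N + 1) (by omega)
  refine ⟨by rw [core, e0α, e0β, e0W], ?_⟩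
  rw [core, eα, eβ, eW]; push_cast; ring_nf

end Band

end ChainPlanar

end Transplant

end Summit.CriticalPhenomena.PercolationContinuityZ3.Theorems

end
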